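import Mathlib
import Summits.ValiantsHypothesis.ValiantsHypothesis.Theses.NewtonUnitEquations
import Summits.ValiantsHypothesis.ValiantsHypothesis.Theorems.DissociatedFixedK.Negative.LoadBearing

/-!
# `NewtonTauWeak` (stmt-ValiantsHypothesis-5904) — the zonogon: KPTT's `k = 1` bound is attained, so the
# `m`-dependence of the weak bound is indispensable (negative lane, part 1)

Negative knowledge for the crux
`Summit.ValiantsHypothesis.ValiantsHypothesis.Theses.NewtonUnitEquations.NewtonTauWeak` (route
NewtonUnitEquations, rank-0 target): KPTT's τ-conjecture for Newton polygons (arXiv:1308.2286, Conj. 1)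
in the weak form of their Theorem 1, `vert(Σ_{i<k} Π_{j<m} f_ij) ≤ 2^{a m}(k t + 2)^b` for `t`-sparse
bivariate `f_ij` over `ℂ`.  From the standing disprover's `Cruxes/NewtonTauWeak/Disproof.lean` §0/§C
(the crux itself is an OPEN conjecture; nothing here decides it):

* `vert` — the crux's literal vertex count, `vert_le_card_support`;
* `zProd m = Π_{j<m} (1 + X Y^j)`: expansion `zProd_eq_sum`, `coeff_zProd` (coefficients are subset
  COUNTS, so no uniqueness of subset sums is ever needed), `mem_support_zProd_iff`;
* `sum_lt_sum_filter_pos` — the zonotope vertex criterion: a weight function with no zero on `S` is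
  maximised over `T ⊆ S` exactly at its positive set; hence both chains `Ico s m` (via `ℓ_s = y-(s-½)x`)
  and `range s` (via `-ℓ_s`) are vertices: `succ_le_vert_zProd` (`m+1 ≤ vert`), `two_mul_le_vert_zProd`
  (`2m ≤ vert`, i.e. KPTT's no-cancellation bound `m·t` for ONE product is attained at `t = 2`);
* `not_newtonTauBoundNoM` — consequently the `a = 0` form `vert ≤ (kt+2)^b` of the crux is FALSE:
  every proof of NewtonTauWeak must let the bound grow with `m` (all the slack of the weak form is the
  factor `2^{am}` against the true `k = 1` value `m t`).
[folklore; KPTT arXiv:1308.2286 §2 for the `k = 1` bound]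
-/

set_option linter.dupNamespace false

namespace Summit.ValiantsHypothesis.ValiantsHypothesis.Theorems.NewtonTauWeak.Negative

open scoped BigOperators
open MvPolynomial Finset
open Summit.ValiantsHypothesis.ValiantsHypothesis.Theses.NewtonUnitEquations (NewtonTauWeak)
open Summit.ValiantsHypothesis.ValiantsHypothesis.Theorems.DissociatedFixedK.Negative
  (chainPt chainPoly chainPt_injective support_chainPoly vertices_chainPoly
   mem_extremePoints_convexHull_of_strict_sep emb emb_injective)

noncomputable section

/-! ## §0 The crux's vertex count -/

/-- The crux's vertex count of a bivariate polynomial: number of extreme points of the convex hull of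
the support embedded in `ℝ²` (literal subterm of the crux). -/
def vert (p : MvPolynomial (Fin 2) ℂ) : ℕ :=
  (Set.extremePoints ℝ (convexHull ℝ ((fun e : Fin 2 →₀ ℕ => fun i : Fin 2 => ((e i : ℕ) : ℝ)) ''
    (p.support : Set (Fin 2 →₀ ℕ))))).ncard

/-- The vertex count is at most the number of monomials (so `vert ≤ k·t^m` trivially; no junk values). -/
theorem vert_le_card_support (p : MvPolynomial (Fin 2) ℂ) : vert p ≤ p.support.card := by
  unfold vert
  have hfin : ((fun e : Fin 2 →₀ ℕ => fun i : Fin 2 => ((e i : ℕ) : ℝ)) ''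
      (p.support : Set (Fin 2 →₀ ℕ))).Finite := p.support.finite_toSet.image _
  calc (Set.extremePoints ℝ (convexHull ℝ ((fun e : Fin 2 →₀ ℕ => fun i : Fin 2 => ((e i : ℕ) : ℝ)) ''
        (p.support : Set (Fin 2 →₀ ℕ))))).ncard
      ≤ ((fun e : Fin 2 →₀ ℕ => fun i : Fin 2 => ((e i : ℕ) : ℝ)) '' (p.support : Set (Fin 2 →₀ ℕ))).ncard :=
        Set.ncard_le_ncard extremePoints_convexHull_subset hfin
    _ ≤ (p.support : Set (Fin 2 →₀ ℕ)).ncard := Set.ncard_image_le p.support.finite_toSet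
    _ = p.support.card := Set.ncard_coe_finset _

/-! ## §C Zonogon machinery: `Π_{j<m} (1 + X·Y^j)` -/

/-- General strict exposure on subsets (the zonotope vertex criterion): if no weight vanishes on `S`,
then among `T ⊆ S` the sum `Σ_{j∈T} w j` is maximised EXACTLY at the set of indices of positive weight. -/
theorem sum_lt_sum_filter_pos (S T : Finset ℕ) (w : ℕ → ℝ) (hw : ∀ j ∈ S, w j ≠ 0) (hT : T ⊆ S)
    (hne : T ≠ S.filter (fun j => 0 < w j)) :
    ∑ j ∈ T, w j < ∑ j ∈ S.filter (fun j => 0 < w j), w j := by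
  classical
  set U := S.filter (fun j => 0 < w j) with hU
  have hdecT : ∑ j ∈ T, w j = ∑ j ∈ T ∩ U, w j + ∑ j ∈ T \ U, w j :=
    (Finset.sum_inter_add_sum_sdiff T U _).symm
  have hdecU : ∑ j ∈ U, w j = ∑ j ∈ U ∩ T, w j + ∑ j ∈ U \ T, w j :=
    (Finset.sum_inter_add_sum_sdiff U T _).symm
  have hneg : ∀ j ∈ T \ U, w j < 0 := by
    intro j hj
    rw [Finset.mem_sdiff] at hj
    have hjS : j ∈ S := hT hj.1
    have hnot : ¬ 0 < w j := fun h => hj.2 (Finset.mem_filter.mpr ⟨hjS, h⟩)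
    exact lt_of_le_of_ne (not_lt.mp hnot) (hw j hjS)
  have hposU : ∀ j ∈ U \ T, 0 < w j := by
    intro j hj
    rw [Finset.mem_sdiff, Finset.mem_filter] at hj
    exact hj.1.2
  have h1 : ∑ j ∈ T \ U, w j ≤ 0 := Finset.sum_nonpos fun j hj => (hneg j hj).le
  have h2 : 0 ≤ ∑ j ∈ U \ T, w j := Finset.sum_nonneg fun j hj => (hposU j hj).le
  have hIT : T ∩ U = U ∩ T := Finset.inter_comm _ _
  by_cases hA : (T \ U).Nonempty
  · have h1' : ∑ j ∈ T \ U, w j < 0 := Finset.sum_neg hneg hA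
    rw [hdecT, hdecU, hIT]
    linarith
  · rw [Finset.not_nonempty_iff_eq_empty, Finset.sdiff_eq_empty_iff_subset] at hA
    have hB : (U \ T).Nonempty := by
      rw [Finset.nonempty_iff_ne_empty, Ne, Finset.sdiff_eq_empty_iff_subset]
      intro hUT
      exact hne (Finset.Subset.antisymm hA hUT)
    have h2' : 0 < ∑ j ∈ U \ T, w j := Finset.sum_pos hposU hB
    have hTU : T \ U = ∅ := Finset.sdiff_eq_empty_iff_subset.mpr hA
    rw [hdecT, hdecU, hIT, hTU, Finset.sum_empty]
    linarith

/-- Exponent vector of the monomial `X Y^j`. -/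
def v (j : ℕ) : Fin 2 →₀ ℕ := Finsupp.single 0 1 + Finsupp.single 1 j

/-- `X`-degree of `X Y^j`. -/
@[simp] theorem v_zero (j : ℕ) : v j 0 = 1 := by simp [v]

/-- `Y`-degree of `X Y^j`. -/
@[simp] theorem v_one (j : ℕ) : v j 1 = j := by simp [v]

/-- The binomial factor `1 + X Y^j` (2 monomials). -/
def zFactor (j : ℕ) : MvPolynomial (Fin 2) ℂ := 1 + monomial (v j) 1

/-- Exponent of the expansion term indexed by a set `T` of factor indices: `Σ_{j∈T} v j`. -/
def expo (T : Finset ℕ) : Fin 2 →₀ ℕ := ∑ j ∈ T, v j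

/-- `X`-degree of the `T`-term: `|T|`. -/
theorem expo_zero (T : Finset ℕ) : expo T 0 = T.card := by
  simp [expo, Finsupp.finsetSum_apply]

/-- `Y`-degree of the `T`-term: `Σ T`. -/
theorem expo_one (T : Finset ℕ) : expo T 1 = ∑ j ∈ T, j := by
  simp [expo, Finsupp.finsetSum_apply]

/-- The zonogon polynomial `zProd m = Π_{j<m} (1 + X Y^j)`. -/
def zProd (m : ℕ) : MvPolynomial (Fin 2) ℂ := ∏ j ∈ range m, zFactor j

/-- Expansion: `Π_{j<m}(1 + X Y^j) = Σ_{T ⊆ range m} X^{|T|} Y^{Σ T}`. -/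
theorem zProd_eq_sum (m : ℕ) : zProd m = ∑ T ∈ (range m).powerset, monomial (expo T) 1 := by
  unfold zProd zFactor
  rw [Finset.prod_one_add]
  refine Finset.sum_congr rfl fun T _ => ?_
  rw [expo, monomial_sum_one]

/-- Coefficient of `zProd m` at `e` = number of `T ⊆ range m` with `expo T = e` (a natural number:
all coefficients are non-negative, so NO uniqueness of subset sums is needed below). -/
theorem coeff_zProd (m : ℕ) (e : Fin 2 →₀ ℕ) :
    coeff e (zProd m) = (((range m).powerset.filter fun T => expo T = e).card : ℂ) := by
  classical
  rw [zProd_eq_sum, coeff_sum]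
  simp only [coeff_monomial]
  rw [Finset.sum_boole]

/-- Support of `zProd m` = exponents of the form `expo T`, `T ⊆ range m`. -/
theorem mem_support_zProd_iff (m : ℕ) (e : Fin 2 →₀ ℕ) :
    e ∈ (zProd m).support ↔ ∃ T ⊆ range m, expo T = e := by
  classical
  rw [mem_support_iff, coeff_zProd, Nat.cast_ne_zero, ← pos_iff_ne_zero, Finset.card_pos]
  constructor
  · rintro ⟨T, hT⟩
    rw [Finset.mem_filter, Finset.mem_powerset] at hT
    exact ⟨T, hT.1, hT.2⟩
  · rintro ⟨T, hT, he⟩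
    exact ⟨T, by rw [Finset.mem_filter, Finset.mem_powerset]; exact ⟨hT, he⟩⟩

/-- Sparsity of the factors: `1 + X Y^j` has at most 2 monomials. -/
theorem card_support_zFactor (j : ℕ) : (zFactor j).support.card ≤ 2 := by
  classical
  unfold zFactor
  calc (1 + monomial (v j) (1 : ℂ)).support.card
      ≤ ((1 : MvPolynomial (Fin 2) ℂ).support ∪ (monomial (v j) (1 : ℂ)).support).card :=
        Finset.card_le_card support_add
    _ ≤ (1 : MvPolynomial (Fin 2) ℂ).support.card + (monomial (v j) (1 : ℂ)).support.card :=
        Finset.card_union_le _ _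
    _ ≤ 1 + 1 := by
        gcongr
        · rw [support_one]; simp
        · exact (Finset.card_le_card support_monomial_subset).trans (by simp)

/-- The `k = 1` instance of the crux's sum-of-products with factors `1 + X Y^j` is `zProd m`. -/
theorem sum_prod_zFactor (m : ℕ) :
    (∑ _i : Fin 1, ∏ j : Fin m, zFactor (j : ℕ)) = zProd m := by
  rw [Fin.sum_univ_one (fun _ => ∏ j : Fin m, zFactor (j : ℕ))]
  exact Fin.prod_univ_eq_prod_range zFactor m

/-- The exposing functional for the vertex `T_s = Ico s m`: `ℓ_s(x, y) = y - (s - 1/2)·x`. -/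
def zExp (s : ℕ) : (Fin 2 → ℝ) →ₗ[ℝ] ℝ :=
  LinearMap.proj 1 - ((s : ℝ) - 1 / 2) • LinearMap.proj 0

/-- Evaluation of `ℓ_s`. -/
theorem zExp_apply (s : ℕ) (p : Fin 2 → ℝ) : zExp s p = p 1 - ((s : ℝ) - 1 / 2) * p 0 := by
  simp [zExp, smul_eq_mul]

/-- Weight of index `j` under `ℓ_s`: `j - s + 1/2` (positive iff `j ≥ s`, never zero). -/
def wt (s j : ℕ) : ℝ := (j : ℝ) - s + 1 / 2

/-- `ℓ_s` of the `T`-term is the weight sum `Σ_{j∈T} (j - s + 1/2)`. -/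
theorem zExp_emb_expo (s : ℕ) (T : Finset ℕ) : zExp s (emb (expo T)) = ∑ j ∈ T, wt s j := by
  rw [zExp_apply]
  simp only [emb, expo_zero, expo_one, wt]
  push_cast
  rw [Finset.sum_add_distrib, Finset.sum_sub_distrib, Finset.sum_const, Finset.sum_const, nsmul_eq_mul,
    nsmul_eq_mul]
  ring

/-- Weights are positive from `s` on. -/
theorem wt_pos {s j : ℕ} (h : s ≤ j) : 0 < wt s j := by
  unfold wt
  have : (s : ℝ) ≤ j := by exact_mod_cast h
  linarith

/-- Weights are negative below `s`. -/
theorem wt_neg {s j : ℕ} (h : j < s) : wt s j < 0 := by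
  unfold wt
  have : (j : ℝ) + 1 ≤ s := by exact_mod_cast h
  linarith

/-- No weight vanishes. -/
theorem wt_ne_zero (s j : ℕ) : wt s j ≠ 0 := by
  rcases lt_or_ge j s with hj | hj
  · exact (wt_neg hj).ne
  · exact (wt_pos hj).ne'

/-- The indices of POSITIVE `ℓ_s`-weight inside `range m` form `Ico s m`. -/
theorem filter_pos_wt (m s : ℕ) : (range m).filter (fun j => 0 < wt s j) = Ico s m := by
  ext j
  simp only [Finset.mem_filter, Finset.mem_range, Finset.mem_Ico]
  constructor
  · rintro ⟨hjm, h⟩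
    refine ⟨?_, hjm⟩
    by_contra hjs
    push Not at hjs
    exact absurd (wt_neg hjs) (not_lt.mpr h.le)
  · rintro ⟨hsj, hjm⟩
    exact ⟨hjm, wt_pos hsj⟩

/-- The indices of NEGATIVE `ℓ_s`-weight inside `range m` form `range s` (for `s ≤ m`). -/
theorem filter_neg_wt (m s : ℕ) (hs : s ≤ m) :
    (range m).filter (fun j => 0 < -wt s j) = range s := by
  ext j
  simp only [Finset.mem_filter, Finset.mem_range, neg_pos]
  constructor
  · rintro ⟨-, h⟩
    by_contra hjs
    push Not at hjs
    exact absurd (wt_pos hjs) (not_lt.mpr h.le)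
  · intro hj
    exact ⟨lt_of_lt_of_le hj hs, wt_neg hj⟩

/-- Every `Ico s m` indexes a Newton-polygon VERTEX of `zProd m` (upper chain of the zonogon, exposed
by `ℓ_s`). -/
theorem emb_expo_Ico_mem_extremePoints (m s : ℕ) :
    emb (expo (Ico s m)) ∈
      Set.extremePoints ℝ (convexHull ℝ (emb '' ((zProd m).support : Set (Fin 2 →₀ ℕ)))) := by
  classical
  apply mem_extremePoints_convexHull_of_strict_sep (l := zExp s)
  · refine ⟨expo (Ico s m), ?_, rfl⟩
    rw [Finset.mem_coe, mem_support_zProd_iff]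
    exact ⟨Ico s m, fun j hj => Finset.mem_range.mpr (Finset.mem_Ico.mp hj).2, rfl⟩
  · rintro y ⟨e, he, rfl⟩ hne
    rw [Finset.mem_coe, mem_support_zProd_iff] at he
    obtain ⟨T, hT, rfl⟩ := he
    rw [zExp_emb_expo, zExp_emb_expo, ← filter_pos_wt m s]
    apply sum_lt_sum_filter_pos (range m) T (wt s) (fun j _ => wt_ne_zero s j) hT
    rw [filter_pos_wt m s]
    rintro rfl
    exact hne rfl

/-- Every `range s` (`s ≤ m`) indexes a Newton-polygon VERTEX of `zProd m` (lower chain of the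
zonogon, exposed by `-ℓ_s`). -/
theorem emb_expo_range_mem_extremePoints (m s : ℕ) (hs : s ≤ m) :
    emb (expo (range s)) ∈
      Set.extremePoints ℝ (convexHull ℝ (emb '' ((zProd m).support : Set (Fin 2 →₀ ℕ)))) := by
  classical
  apply mem_extremePoints_convexHull_of_strict_sep (l := -zExp s)
  · refine ⟨expo (range s), ?_, rfl⟩
    rw [Finset.mem_coe, mem_support_zProd_iff]
    exact ⟨range s, Finset.range_subset_range.mpr hs, rfl⟩
  · rintro y ⟨e, he, rfl⟩ hne
    rw [Finset.mem_coe, mem_support_zProd_iff] at he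
    obtain ⟨T, hT, rfl⟩ := he
    simp only [LinearMap.neg_apply, zExp_emb_expo]
    rw [← Finset.sum_neg_distrib, ← Finset.sum_neg_distrib, ← filter_neg_wt m s hs]
    apply sum_lt_sum_filter_pos (range m) T (fun j => -wt s j)
      (fun j _ => neg_ne_zero.mpr (wt_ne_zero s j)) hT
    rw [filter_neg_wt m s hs]
    rintro rfl
    exact hne rfl

/-- `Σ_{j ∈ Ico s m} j = s (m - s) + Σ_{j < m - s} j` (shifted arithmetic series). -/
theorem sum_Ico_id (s m : ℕ) : ∑ j ∈ Ico s m, j = s * (m - s) + ∑ j ∈ range (m - s), j := by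
  rw [Finset.sum_Ico_eq_sum_range, Finset.sum_add_distrib, Finset.sum_const, Finset.card_range,
    smul_eq_mul, mul_comm]

/-- Lower bound from the upper chain alone: `zProd m` has at least `m + 1` Newton-polygon vertices. -/
theorem succ_le_vert_zProd (m : ℕ) : m + 1 ≤ vert (zProd m) := by
  classical
  unfold vert
  rw [show (fun e : Fin 2 →₀ ℕ => fun i : Fin 2 => ((e i : ℕ) : ℝ)) = emb from rfl]
  set S := emb '' ((zProd m).support : Set (Fin 2 →₀ ℕ)) with hS
  have hfin : (Set.extremePoints ℝ (convexHull ℝ S)).Finite :=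
    (((zProd m).support.finite_toSet.image emb).subset extremePoints_convexHull_subset)
  let P : Finset (Fin 2 → ℝ) := (range (m + 1)).image fun s => emb (expo (Ico s m))
  have hPcard : P.card = m + 1 := by
    rw [Finset.card_image_of_injOn, Finset.card_range]
    intro s hs s' hs' h
    have h0 := congrFun h 0
    simp only [emb, expo_zero, Nat.card_Ico, Nat.cast_inj] at h0
    have hs := Finset.mem_range.mp hs
    have hs' := Finset.mem_range.mp hs'
    omega
  have hPsub : (P : Set (Fin 2 → ℝ)) ⊆ Set.extremePoints ℝ (convexHull ℝ S) := by
    intro p hp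
    rw [Finset.mem_coe, Finset.mem_image] at hp
    obtain ⟨s, -, rfl⟩ := hp
    exact emb_expo_Ico_mem_extremePoints m s
  calc m + 1 = P.card := hPcard.symm
    _ = (P : Set (Fin 2 → ℝ)).ncard := (Set.ncard_coe_finset P).symm
    _ ≤ (Set.extremePoints ℝ (convexHull ℝ S)).ncard := Set.ncard_le_ncard hPsub hfin

/-- **Exact tightness at `k = 1`, `t = 2`: the zonogon has at least `2m` vertices** (`= m·t`, KPTT's
no-cancellation bound for one product, which by Ostrowski `Newt(fg) = Newt f + Newt g` is also an upper
bound), namely the `m + 1` upper-chain points `Ico s m` and the `m - 1` lower-chain points `range s`,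
`0 < s < m`. -/
theorem two_mul_le_vert_zProd (m : ℕ) : 2 * m ≤ vert (zProd m) := by
  classical
  rcases Nat.eq_zero_or_pos m with rfl | hm
  · simp
  unfold vert
  rw [show (fun e : Fin 2 →₀ ℕ => fun i : Fin 2 => ((e i : ℕ) : ℝ)) = emb from rfl]
  set S := emb '' ((zProd m).support : Set (Fin 2 →₀ ℕ)) with hS
  have hfin : (Set.extremePoints ℝ (convexHull ℝ S)).Finite :=
    (((zProd m).support.finite_toSet.image emb).subset extremePoints_convexHull_subset)
  let P₁ : Finset (Fin 2 → ℝ) := (range (m + 1)).image fun s => emb (expo (Ico s m))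
  let P₂ : Finset (Fin 2 → ℝ) := (Ico 1 m).image fun s => emb (expo (range s))
  have hP₁card : P₁.card = m + 1 := by
    rw [Finset.card_image_of_injOn, Finset.card_range]
    intro s hs s' hs' h
    have h0 := congrFun h 0
    simp only [emb, expo_zero, Nat.card_Ico, Nat.cast_inj] at h0
    have hs := Finset.mem_range.mp hs
    have hs' := Finset.mem_range.mp hs'
    omega
  have hP₂card : P₂.card = m - 1 := by
    rw [Finset.card_image_of_injOn, Nat.card_Ico]
    intro s hs s' hs' h
    have h0 := congrFun h 0
    simpa [emb, expo_zero] using h0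
  have hdisj : Disjoint P₁ P₂ := by
    rw [Finset.disjoint_left]
    intro p hp₁ hp₂
    rw [Finset.mem_image] at hp₁ hp₂
    obtain ⟨s, hs, rfl⟩ := hp₁
    obtain ⟨s', hs', h⟩ := hp₂
    have hs := Finset.mem_range.mp hs
    rw [Finset.mem_Ico] at hs'
    have h0 := congrFun h 0
    have h1 := congrFun h 1
    simp only [emb, expo_zero, expo_one, Nat.card_Ico, Finset.card_range, Nat.cast_inj] at h0 h1
    rw [sum_Ico_id, ← h0] at h1
    have hpos : 0 < s * s' := Nat.mul_pos (by omega) (by omega)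
    omega
  have hsub : ((P₁ ∪ P₂ : Finset (Fin 2 → ℝ)) : Set (Fin 2 → ℝ)) ⊆
      Set.extremePoints ℝ (convexHull ℝ S) := by
    intro p hp
    rw [Finset.mem_coe, Finset.mem_union] at hp
    rcases hp with hp | hp
    · rw [Finset.mem_image] at hp
      obtain ⟨s, -, rfl⟩ := hp
      exact emb_expo_Ico_mem_extremePoints m s
    · rw [Finset.mem_image] at hp
      obtain ⟨s, hs, rfl⟩ := hp
      rw [Finset.mem_Ico] at hs
      exact emb_expo_range_mem_extremePoints m s hs.2.le
  calc 2 * m = (m + 1) + (m - 1) := by omega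
    _ = (P₁ ∪ P₂).card := by rw [Finset.card_union_of_disjoint hdisj, hP₁card, hP₂card]
    _ = ((P₁ ∪ P₂ : Finset (Fin 2 → ℝ)) : Set (Fin 2 → ℝ)).ncard := (Set.ncard_coe_finset _).symm
    _ ≤ (Set.extremePoints ℝ (convexHull ℝ S)).ncard := Set.ncard_le_ncard hsub hfin

/-- The weak bound with the `m`-dependence removed (`a = 0`): a bound polynomial in `kt` alone. -/
def NewtonTauBoundNoM : Prop :=
  ∃ b : ℕ, ∀ (k m t : ℕ) (f : Fin k → Fin m → MvPolynomial (Fin 2) ℂ),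
    (∀ i j, (f i j).support.card ≤ t) → vert (∑ i, ∏ j, f i j) ≤ (k * t + 2) ^ b

/-- **`m` is indispensable (the `2^{am}` factor cannot be replaced by `1`)**: with `k = 1`, `t = 2`
the product of the `m` binomials `1 + X Y^j` (a zonogon) has `≥ 2m` vertices, unbounded against
`(1·2+2)^b`.  Equivalently: NewtonTauWeak with `a = 0` is FALSE; KPTT's no-cancellation bound `k·m·t`
is attained at `k = 1`, so any proof must let the bound grow with `m`. -/
theorem not_newtonTauBoundNoM : ¬ NewtonTauBoundNoM := by
  rintro ⟨b, h⟩
  set M := 4 ^ b with hM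
  have hle := h 1 M 2 (fun _ j => zFactor (j : ℕ)) (fun _ j => card_support_zFactor _)
  rw [sum_prod_zFactor] at hle
  have hlow := succ_le_vert_zProd M
  have : (1 * 2 + 2) ^ b = 4 ^ b := by norm_num
  rw [this] at hle
  omega

end

end Summit.ValiantsHypothesis.ValiantsHypothesis.Theorems.NewtonTauWeak.Negative
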